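import Summits.ResolutionOfSingularities.ResolutionOfSingularities.Theorems.PurelyInseparableDim4ChartAtlasSNCFarShearAlgebra
import HarnessLib

/-!
# Purely inseparable four-folds `z^p + F(x₁, …, x₄)`: the FAR GOOD SHEAR CHART of the S3-N1 atlas (S3-N2 positive side; typ-2 g6)

[OURS · counted 0] (D-0157 DOOR 2; DR-157-C; desk WORD #115 (a)/(c), #131 (c); typ-2 g5 HANDOFF OPEN item 1). Companion of
p701847's `hasSNCWith_𝓘Λ_of_forall_mem_far` (the `x_j`-chart) for the other cover charts `x_l`, `l ∈ S ∖ S'`, `l ≠ j`, of the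
escaping global centre (p688180): there the centre reads `V(y_0, y_T)` (`j, l ∉ T`) and the transformed boundary reads `⊤`,
hyperplanes `(y_k + a)·𝒪` (`E₁ = {y_l = 0}`, old `{x_j = 0}`, transversal members, the far `{x_l = -d_l}`), SHEARED near members
`(y_m + b_m·y_j)·𝒪` (p696282), and the far QUADRICS `F_j = (y_j·y_l + d_j)·𝒪`, `Fᵢ = ((yᵢ + bᵢ·y_j)·y_l + dᵢ)·𝒪`. PROVED here:
**`hasSNCWith_𝓘Λ_of_forall_mem_far_shear`** — if the near bad set has at most one element (`|B| ≤ 1` of p690374/p691155), the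
hyperplanes of index `j`, `m ∈ sh`, `i ∈ fs` are the ones the dictionary produces, and NO TWO ACTIVE FAR MEMBERS SHARE A HEIGHT
(`dᵢ ≠ bᵢ·d_j`, `dᵢ·b_k ≠ d_k·bᵢ` on `fs ∩ T`, `b ≠ 0`), then `HasSNCWith E (𝓘Λ 4 K ({0} ∪ T⁺))`. Method: the Jacobian engine
p701374 with owners/ranks hyperplane ↦ its variable (0), `F_j ↦ y_j` (1), active `Fᵢ ↦ y_j` (1) / other `Fᵢ ↦ yᵢ` (4), sheared into
the centre `↦ y_j` (2) / other sheared `↦ y_m` (3), and the bookkeeping p702533. Nothing here is a statement about resolution of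
singularities in dimension ≥ 4 / characteristic `p` (NOT proved anywhere in this programme). bears_on: LADDER-RESOLUTION:D157-DOOR2
(res-dim4-pi). Supports stmt-ResolutionOfSingularities-16155 (helper, S3-N2 positive side with far members).
-/

-- every declaration of this summit lives under `Summit.ResolutionOfSingularities.ResolutionOfSingularities`
-- (summit = problem), which the duplicate-namespace linter flags; house convention (cf. the Target file).
set_option linter.dupNamespace false

noncomputable section

open MvPolynomial CategoryTheory AlgebraicGeometry Opposite TopologicalSpace
open AlgebraicGeometry.Scheme.IdealSheafData (ofIdealTop)

namespace Summit.ResolutionOfSingularities.ResolutionOfSingularities.Theorems.PIDim4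

open Literature.AlgebraicGeometry.Resolution
open Literature.AlgebraicGeometry.Resolution.AffinePointBlowup (P A γ coord Wtop ξ)

namespace ChartDictionary

variable {K : Type} [Field K]

/-! ## The far good shear chart -/

variable {T : Finset (Fin 4)} {j l : Fin 4} {b d : Fin 4 → K}

/-- **THE FAR GOOD SHEAR CHART (S3-N2 positive side with far members, shear chart `x_l`, escaping case).** Centre `V(y_0, y_T)`,
`j, l ∉ T`, `j ≠ l`. Members: `⊤`; hyperplanes `(y_k + a)·𝒪`, `(k, a) ∈ H` (no index `m⁺`, `m ∈ sh`, nor `i⁺`, `i ∈ fs`; index `j⁺`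
only with `a = 0`); sheared near members `(y_m + b_m·y_j)·𝒪`, `m ∈ sh` (`m ≠ j, l`); the far quadric `F_j = (y_j·y_l + d_j)·𝒪` if
`j ∈ fs`; far quadrics `Fᵢ = ((yᵢ + bᵢ·y_j)·y_l + dᵢ)·𝒪`, `i ∈ fs ∖ {j}` (`l ∉ fs`, `d ≠ 0` on `fs`). Hypotheses: the near bad set has
at most one element — `(j⁺, 0) ∈ H →` no `m ∈ sh ∩ T` with `b_m ≠ 0`, and at most one `m ∈ sh ∩ T` with `b_m ≠ 0` —, and no two
ACTIVE far members share a height: `dᵢ ≠ bᵢ·d_j` (`i ∈ fs ∩ T`, `bᵢ ≠ 0`, `j ∈ fs`) and `dᵢ·b_k ≠ d_k·bᵢ` (`i ≠ k ∈ fs ∩ T`,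
`bᵢ, b_k ≠ 0`). Then `HasSNCWith E (𝓘Λ 4 K ({0} ∪ T⁺))`. -/
theorem hasSNCWith_𝓘Λ_of_forall_mem_far_shear (hjT : j ∉ T) (hlT : l ∉ T) (hjl : j ≠ l) (H : Finset (Fin (4 + 1) × K))
    (sh fs : Finset (Fin 4)) (hjsh : j ∉ sh) (hlsh : l ∉ sh) (hlfs : l ∉ fs) (hd : ∀ i ∈ fs, d i ≠ 0)
    (hHj : ∀ a : K, (j.succ, a) ∈ H → a = 0) (hHsh : ∀ m ∈ sh, b m ≠ 0 → ∀ a : K, (m.succ, a) ∉ H)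
    (hHfs : ∀ i ∈ fs, i ≠ j → ∀ a : K, (i.succ, a) ∈ H → a = 0 ∧ b i = 0)
    (hB1 : (j.succ, (0 : K)) ∈ H → ∀ m ∈ sh, m ∈ T → b m = 0)
    (hB2 : ∀ m ∈ sh, ∀ m' ∈ sh, m ∈ T → m' ∈ T → b m ≠ 0 → b m' ≠ 0 → m = m')
    (hC2 : ∀ i ∈ fs, i ≠ j → i ∈ T → b i ≠ 0 → j ∈ fs → d i ≠ b i * d j)
    (hC3 : ∀ i ∈ fs, ∀ k ∈ fs, i ≠ j → k ≠ j → i ≠ k → i ∈ T → k ∈ T → b i ≠ 0 → b k ≠ 0 → d i * b k ≠ d k * b i)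
    {E : List (Scheme.IdealSheafData (P 4 K))}
    (hE : ∀ D ∈ E, D = ⊤ ∨ (∃ ka ∈ H, D = ofIdealTop (Ideal.span {(γ 4 K).symm (X ka.1 + C ka.2)})) ∨
      (∃ m ∈ sh, D = ofIdealTop (Ideal.span {(γ 4 K).symm (X m.succ + C (b m) * X j.succ)})) ∨
      (j ∈ fs ∧ D = ofIdealTop (Ideal.span {(γ 4 K).symm (X j.succ * X l.succ + C (d j))})) ∨
      ∃ i ∈ fs, i ≠ j ∧ D = ofIdealTop (Ideal.span {(γ 4 K).symm ((X i.succ + C (b i) * X j.succ) * X l.succ + C (d i))})) :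
    HasSNCWith E (AffineCoordBlowup.𝓘Λ 4 K (insert 0 (Fin.succ '' (T : Set (Fin 4))))) := by
  classical
  set Λ : Set (Fin (4 + 1)) := insert 0 (Fin.succ '' (T : Set (Fin 4))) with hΛ
  let hyp : Fin (4 + 1) × K → A 4 K := fun ka => X ka.1 + C ka.2
  let Sh : Fin 4 → A 4 K := fun m => X m.succ + C (b m) * X j.succ
  let Fj : A 4 K := X j.succ * X l.succ + C (d j)
  let F : Fin 4 → A 4 K := fun i => (X i.succ + C (b i) * X j.succ) * X l.succ + C (d i)
  let Φ : Finset (A 4 K) := H.image hyp ∪ sh.image Sh ∪ (if j ∈ fs then {Fj} else ∅) ∪ (fs.erase j).image F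
  let act : P 4 K → Fin 4 → Prop := fun x i => i.succ ∈ Λ ∧ ∀ k ∈ Λ, (X k : A 4 K) ∈ x.asIdeal
  let v : P 4 K → A 4 K → Fin (4 + 1) := fun x q =>
    if h : ∃ ka : Fin (4 + 1) × K, q = hyp ka then h.choose.1
    else if h : ∃ m : Fin 4, m ≠ j ∧ b m ≠ 0 ∧ q = Sh m then (if act x h.choose then j.succ else h.choose.succ)
    else if q = Fj then j.succ
    else if h : ∃ i : Fin 4, i ≠ j ∧ i ≠ l ∧ q = F i then (if act x h.choose then j.succ else h.choose.succ) else 0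
  let ρ : P 4 K → A 4 K → ℕ := fun x q =>
    if ∃ ka : Fin (4 + 1) × K, q = hyp ka then 0
    else if h : ∃ m : Fin 4, m ≠ j ∧ b m ≠ 0 ∧ q = Sh m then (if act x h.choose then 2 else 3)
    else if q = Fj then 1
    else if h : ∃ i : Fin 4, i ≠ j ∧ i ≠ l ∧ q = F i then (if act x h.choose then 1 else 4) else 0
  have hhyp : ∀ x (k : Fin (4 + 1)) (a : K), v x (X k + C a) = k ∧ ρ x (X k + C a) = 0 := by
    intro x k a
    have h : ∃ ka : Fin (4 + 1) × K, (X k + C a : A 4 K) = hyp ka := ⟨(k, a), rfl⟩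
    simp only [v, ρ, dif_pos h, if_pos h, and_true]
    exact (X_add_C_eq_X_add_C_iff.mp h.choose_spec).1.symm
  have hSh1 : ∀ m, m ≠ j → b m ≠ 0 → ¬ ∃ ka : Fin (4 + 1) × K, Sh m = hyp ka :=
    fun m hmj hbm ⟨ka, hka⟩ => shear_ne_X_add_C hmj hbm ka.1 ka.2 hka
  have hSh2 : ∀ m, m ≠ j → b m ≠ 0 → ∀ h : ∃ m' : Fin 4, m' ≠ j ∧ b m' ≠ 0 ∧ Sh m = Sh m', h.choose = m := by
    intro m hmj hbm h
    obtain ⟨h1, -, h3⟩ := h.choose_spec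
    exact ((shear_eq_shear_iff hmj h1).mp h3).symm
  have hSh : ∀ x m, m ≠ j → b m ≠ 0 →
      v x (Sh m) = (if act x m then j.succ else m.succ) ∧ ρ x (Sh m) = if act x m then 2 else 3 := by
    intro x m hmj hbm
    have h : ∃ m' : Fin 4, m' ≠ j ∧ b m' ≠ 0 ∧ Sh m = Sh m' := ⟨m, hmj, hbm, rfl⟩
    simp only [v, ρ, dif_neg (hSh1 m hmj hbm), if_neg (hSh1 m hmj hbm), dif_pos h, hSh2 m hmj hbm h, and_self]
  have hFj1 : ¬ ∃ ka : Fin (4 + 1) × K, Fj = hyp ka := fun ⟨ka, hka⟩ => farj_ne_X_add_C hjl ka.1 ka.2 hka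
  have hFj2 : ¬ ∃ m : Fin 4, m ≠ j ∧ b m ≠ 0 ∧ Fj = Sh m := by
    rintro ⟨m, hmj, hbm, h⟩
    have hml : m ≠ l := by
      rintro rfl
      have h1 := congrArg (pderiv m.succ) h
      rw [pderiv_farj_l hjl, pderiv_shear_self hmj] at h1
      have h2 := congrArg (pderiv j.succ) h1
      rw [pderiv_X_self, Derivation.map_one_eq_zero] at h2
      exact one_ne_zero h2
    exact farj_ne_shear hjl hml h
  have hFj : ∀ x, v x Fj = j.succ ∧ ρ x Fj = 1 := by
    intro x
    simp only [v, ρ]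
    rw [dif_neg hFj1, dif_neg hFj2, if_true, if_neg hFj1, dif_neg hFj2, if_true]
    exact ⟨rfl, rfl⟩
  have hF1 : ∀ i, i ≠ j → i ≠ l → ¬ ∃ ka : Fin (4 + 1) × K, F i = hyp ka :=
    fun i hij hil ⟨ka, hka⟩ => far_ne_X_add_C hij hil ka.1 ka.2 hka
  have hF2 : ∀ i, i ≠ j → i ≠ l → ¬ ∃ m : Fin 4, m ≠ j ∧ b m ≠ 0 ∧ F i = Sh m := by
    rintro i hij hil ⟨m, hmj, -, h⟩
    have hml : m ≠ l := by
      rintro rfl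
      have h1 := congrArg (pderiv m.succ) h
      rw [pderiv_far_l hil hjl, pderiv_shear_self hmj] at h1
      have h2 := congrArg (pderiv i.succ) h1
      rw [pderiv_shear_self hij, Derivation.map_one_eq_zero] at h2
      exact one_ne_zero h2
    exact far_ne_shear hij hil hjl hml h
  have hF3 : ∀ i, i ≠ j → i ≠ l → F i ≠ Fj := fun i hij hil => far_ne_farj hij hil
  have hF4 : ∀ i, i ≠ j → i ≠ l → ∀ h : ∃ i' : Fin 4, i' ≠ j ∧ i' ≠ l ∧ F i = F i', h.choose = i := by
    intro i hij hil h
    obtain ⟨h1, h2, h3⟩ := h.choose_spec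
    exact ((far_eq_far_iff hij hil h1 h2).mp h3).symm
  have hF : ∀ x i, i ≠ j → i ≠ l →
      v x (F i) = (if act x i then j.succ else i.succ) ∧ ρ x (F i) = if act x i then 1 else 4 := by
    intro x i hij hil
    have h : ∃ i' : Fin 4, i' ≠ j ∧ i' ≠ l ∧ F i = F i' := ⟨i, hij, hil, rfl⟩
    simp only [v, ρ, dif_neg (hF1 i hij hil), if_neg (hF1 i hij hil), dif_neg (hF2 i hij hil), if_neg (hF3 i hij hil), dif_pos h,
      hF4 i hij hil h, and_self]
  have hmemΛ : ∀ i : Fin 4, i.succ ∈ Λ ↔ i ∈ T := fun i => succ_mem_centreVars_iff T i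
  have hjΛ : j.succ ∉ Λ := fun h => hjT ((hmemΛ j).mp h)
  have hcases : ∀ (x : P 4 K) (q : A 4 K),
      (q ∈ Φ ∧ q ∈ x.asIdeal ∨ (∃ i ∈ Λ, q = X i) ∧ ∀ k ∈ Λ, (X k : A 4 K) ∈ x.asIdeal) →
        (∃ (k : Fin (4 + 1)) (a : K), q = X k + C a ∧
          ((k, a) ∈ H ∨ (∃ m ∈ sh, k = m.succ ∧ a = 0 ∧ b m = 0) ∨ (a = 0 ∧ k ∈ Λ ∧ ∀ k ∈ Λ, (X k : A 4 K) ∈ x.asIdeal))) ∨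
        (∃ m ∈ sh, b m ≠ 0 ∧ q = Sh m) ∨ (j ∈ fs ∧ q = Fj) ∨ ∃ i ∈ fs, i ≠ j ∧ q = F i := by
    rintro x q (⟨hq, -⟩ | ⟨⟨i, hi, rfl⟩, hΛx⟩)
    · rcases Finset.mem_union.mp hq with hq | hq
      · rcases Finset.mem_union.mp hq with hq | hq
        · rcases Finset.mem_union.mp hq with hq | hq
          · obtain ⟨ka, hka, rfl⟩ := Finset.mem_image.mp hq
            exact Or.inl ⟨ka.1, ka.2, rfl, Or.inl hka⟩
          · obtain ⟨m, hm, rfl⟩ := Finset.mem_image.mp hq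
            by_cases hbm : b m = 0
            · refine Or.inl ⟨m.succ, 0, ?_, Or.inr (Or.inl ⟨m, hm, rfl, rfl, hbm⟩)⟩
              change (X m.succ + C (b m) * X j.succ : A 4 K) = X m.succ + C 0
              rw [hbm, C_0, zero_mul]
            · exact Or.inr (Or.inl ⟨m, hm, hbm, rfl⟩)
        · by_cases hjfs : j ∈ fs
          · rw [if_pos hjfs, Finset.mem_singleton] at hq
            exact Or.inr (Or.inr (Or.inl ⟨hjfs, hq⟩))
          · rw [if_neg hjfs] at hq
            exact absurd hq (Finset.notMem_empty q)
      · obtain ⟨i, hi, rfl⟩ := Finset.mem_image.mp hq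
        exact Or.inr (Or.inr (Or.inr ⟨i, Finset.mem_of_mem_erase hi, Finset.ne_of_mem_erase hi, rfl⟩))
    · exact Or.inl ⟨i, 0, by rw [C_0, add_zero], Or.inr (Or.inr ⟨rfl, hi, hΛx⟩)⟩
  have hmem𝔭 : ∀ (x : P 4 K) (q : A 4 K),
      (q ∈ Φ ∧ q ∈ x.asIdeal ∨ (∃ i ∈ Λ, q = X i) ∧ ∀ k ∈ Λ, (X k : A 4 K) ∈ x.asIdeal) → q ∈ x.asIdeal := by
    rintro x q (⟨-, h⟩ | ⟨⟨i, hi, rfl⟩, h⟩); exacts [h, h i hi]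
  refine hasSNCWith_𝓘Λ_of_jacobian E Λ Φ ?_ ρ v ?_ ?_
  · -- the members
    intro D hD
    rcases hE D hD with h | ⟨ka, hka, h⟩ | ⟨m, hm, h⟩ | ⟨hjfs, h⟩ | ⟨i, hi, hij, h⟩
    · exact Or.inl h
    · exact Or.inr ⟨hyp ka, by simp only [Φ, Finset.mem_union, Finset.mem_image]; exact Or.inl (Or.inl (Or.inl ⟨ka, hka, rfl⟩)), h⟩
    · exact Or.inr ⟨Sh m, by simp only [Φ, Finset.mem_union, Finset.mem_image]; exact Or.inl (Or.inl (Or.inr ⟨m, hm, rfl⟩)), h⟩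
    · refine Or.inr ⟨Fj, ?_, h⟩
      simp [Φ, hjfs]
    · refine Or.inr ⟨F i, ?_, h⟩
      simp only [Φ, Finset.mem_union, Finset.mem_image]
      exact Or.inr ⟨i, Finset.mem_erase.mpr ⟨hij, hi⟩, rfl⟩
  · -- diagonal
    intro x q hq
    have hq𝔭 := hmem𝔭 x q hq
    rcases hcases x q hq with ⟨k, a, rfl, -⟩ | ⟨m, hm, hbm, rfl⟩ | ⟨hjfs, rfl⟩ | ⟨i, hi, hij, rfl⟩
    · rw [(hhyp x k a).1, pderiv_X_add_C, if_pos rfl]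
      exact fun h1 => x.2.ne_top ((Ideal.eq_top_iff_one _).mpr h1)
    · have hmj : m ≠ j := fun e => hjsh (e ▸ hm)
      rw [(hSh x m hmj hbm).1]
      by_cases hact : act x m
      · rw [if_pos hact, pderiv_shear_j hmj, C_mem_asIdeal_iff]
        exact hbm
      · rw [if_neg hact, pderiv_shear_self hmj]
        exact fun h1 => x.2.ne_top ((Ideal.eq_top_iff_one _).mpr h1)
    · rw [(hFj x).1, pderiv_farj_j hjl]
      exact (X_not_mem_of_farj_mem x (hd j hjfs) hq𝔭).2
    · have hil : i ≠ l := fun e => hlfs (e ▸ hi)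
      rw [(hF x i hij hil).1]
      by_cases hact : act x i
      · rw [if_pos hact, pderiv_far_j hij hjl]
        obtain ⟨-, hbi, -⟩ := far_active x (hd i hi) hq𝔭 (hact.2 _ hact.1)
        intro hmem
        rcases x.2.mem_or_mem hmem with h1 | h1
        · exact hbi ((C_mem_asIdeal_iff x _).mp h1)
        · exact (not_mem_of_far_mem x (hd i hi) hq𝔭).1 h1
      · rw [if_neg hact, pderiv_far_self hij hil]
        exact (not_mem_of_far_mem x (hd i hi) hq𝔭).1
  · -- triangularity
    intro x q q' hq hq' hne hρle
    have hq𝔭 := hmem𝔭 x q hq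
    have hq'𝔭 := hmem𝔭 x q' hq'
    rcases hcases x q hq with ⟨k, a, rfl, hka⟩ | ⟨m, hm, hbm, rfl⟩ | ⟨hjfs, rfl⟩ | ⟨i, hi, hij, rfl⟩
    · -- `q` a hyperplane `y_k + a`: the owner of `q'` is not `y_k`
      rw [pderiv_X_add_C]
      rcases hcases x q' hq' with ⟨k', a', rfl, -⟩ | ⟨m', hm', hbm', rfl⟩ | ⟨hjfs', rfl⟩ | ⟨i', hi', hij', rfl⟩
      · rw [(hhyp x k' a').1]
        by_cases hkk : k' = k
        · subst hkk
          exact absurd (by rw [X_add_C_eq_of_mem_of_mem x hq𝔭 hq'𝔭]) hne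
        · rw [if_neg hkk]; exact x.asIdeal.zero_mem
      · have hm'j : m' ≠ j := fun e => hjsh (e ▸ hm')
        rw [(hSh x m' hm'j hbm').1]
        by_cases hact : act x m'
        · rw [if_pos hact]
          by_cases hkj : j.succ = k
          · -- `y_j + a` with `a = 0` and an active sheared member: two bad members, excluded
            exfalso
            subst hkj
            obtain rfl : a = 0 := by
              rcases hka with h | ⟨m₀, -, -, h, -⟩ | ⟨h, -⟩; exacts [hHj a h, h, h]
            have hH0 : (j.succ, (0 : K)) ∈ H := by
              rcases hka with h | ⟨m₀, hm₀, e, -⟩ | ⟨-, h, -⟩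
              · exact h
              · exact absurd hm₀ (by rw [← Fin.succ_injective _ e]; exact hjsh)
              · exact absurd h hjΛ
            exact hbm' (hB1 hH0 m' hm' ((hmemΛ m').mp hact.1))
          · rw [if_neg hkj]; exact x.asIdeal.zero_mem
        · rw [if_neg hact]
          by_cases hkm : m'.succ = k
          · exfalso
            subst hkm
            rcases hka with h | ⟨m₀, -, e, -, hb0⟩ | ⟨-, hmem, hall⟩
            · exact hHsh m' hm' hbm' a h
            · exact hbm' ((Fin.succ_injective _ e) ▸ hb0)
            · exact hact ⟨hmem, hall⟩
          · rw [if_neg hkm]; exact x.asIdeal.zero_mem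
      · rw [(hFj x).1]
        by_cases hkj : j.succ = k
        · exfalso
          subst hkj
          obtain rfl : a = 0 := by
            rcases hka with h | ⟨m₀, -, -, h, -⟩ | ⟨h, -⟩; exacts [hHj a h, h, h]
          rw [C_0, add_zero] at hq𝔭
          exact (X_not_mem_of_farj_mem x (hd j hjfs') hq'𝔭).1 hq𝔭
        · rw [if_neg hkj]; exact x.asIdeal.zero_mem
      · have hi'l : i' ≠ l := fun e => hlfs (e ▸ hi')
        rw [(hF x i' hij' hi'l).1]
        by_cases hact : act x i'
        · rw [if_pos hact]
          by_cases hkj : j.succ = k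
          · exfalso
            subst hkj
            obtain rfl : a = 0 := by
              rcases hka with h | ⟨m₀, -, -, h, -⟩ | ⟨h, -⟩; exacts [hHj a h, h, h]
            rw [C_0, add_zero] at hq𝔭
            exact (far_active x (hd i' hi') hq'𝔭 (hact.2 _ hact.1)).2.2 hq𝔭
          · rw [if_neg hkj]; exact x.asIdeal.zero_mem
        · rw [if_neg hact]
          by_cases hki : i'.succ = k
          · exfalso
            subst hki
            have hab : a = 0 ∧ b i' = 0 := by
              rcases hka with h | ⟨m₀, -, e, ha0, hb0⟩ | ⟨ha0, hmem, hall⟩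
              · exact hHfs i' hi' hij' a h
              · exact ⟨ha0, (Fin.succ_injective _ e) ▸ hb0⟩
              · exact absurd ⟨hmem, hall⟩ hact
            obtain ⟨rfl, hb0⟩ := hab
            rw [C_0, add_zero] at hq𝔭
            exact (far_active x (hd i' hi') hq'𝔭 hq𝔭).2.1 hb0
          · rw [if_neg hki]; exact x.asIdeal.zero_mem
    · -- `q` a sheared member `y_m + b_m y_j` (`b_m ≠ 0`)
      have hmj : m ≠ j := fun e => hjsh (e ▸ hm)
      have hml : m ≠ l := fun e => hlsh (e ▸ hm)
      rcases hcases x q' hq' with ⟨k', a', rfl, -⟩ | ⟨m', hm', hbm', rfl⟩ | ⟨hjfs', rfl⟩ | ⟨i', hi', hij', rfl⟩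
      · exfalso
        rw [(hhyp x k' a').2, (hSh x m hmj hbm).2] at hρle
        split_ifs at hρle <;> omega
      · have hm'j : m' ≠ j := fun e => hjsh (e ▸ hm')
        have hmm' : m ≠ m' := fun e => hne (by rw [e])
        rw [(hSh x m' hm'j hbm').1]
        by_cases hact' : act x m'
        · -- `q'` active (rank 2 ≥ rank `q`): `q` active too — two bad sheared members, excluded
          exfalso
          have hact : act x m := by
            rw [(hSh x m hmj hbm).2, (hSh x m' hm'j hbm').2, if_pos hact'] at hρle
            by_contra h; rw [if_neg h] at hρle; omega
          exact hmm' (hB2 m hm m' hm' ((hmemΛ m).mp hact.1) ((hmemΛ m').mp hact'.1) hbm hbm')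
        · rw [if_neg hact', pderiv_shear_of_ne (fun e => hmm' (Fin.succ_injective _ e).symm)
            (fun e => hm'j (Fin.succ_injective _ e))]
          · exact x.asIdeal.zero_mem
      · exfalso
        rw [(hFj x).2, (hSh x m hmj hbm).2] at hρle
        split_ifs at hρle <;> omega
      · have hi'l : i' ≠ l := fun e => hlfs (e ▸ hi')
        rw [(hF x i' hij' hi'l).1]
        by_cases hact' : act x i'
        · exfalso
          rw [(hF x i' hij' hi'l).2, (hSh x m hmj hbm).2, if_pos hact'] at hρle
          split_ifs at hρle <;> omega
        · rw [if_neg hact']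
          by_cases hmi : m = i'
          · exfalso
            subst hmi
            exact (not_mem_of_far_mem x (hd m hi') hq'𝔭).2 hq𝔭
          · rw [pderiv_shear_of_ne (fun e => hmi (Fin.succ_injective _ e).symm) (fun e => hij' (Fin.succ_injective _ e))]
            exact x.asIdeal.zero_mem
    · -- `q = F_j`
      obtain ⟨hXj, hXl⟩ := X_not_mem_of_farj_mem x (hd j hjfs) hq𝔭
      rcases hcases x q' hq' with ⟨k', a', rfl, -⟩ | ⟨m', hm', hbm', rfl⟩ | ⟨hjfs', rfl⟩ | ⟨i', hi', hij', rfl⟩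
      · exfalso
        rw [(hhyp x k' a').2, (hFj x).2] at hρle
        omega
      · have hm'j : m' ≠ j := fun e => hjsh (e ▸ hm')
        rw [(hSh x m' hm'j hbm').1]
        by_cases hact' : act x m'
        · exfalso
          exact hXj (X_j_mem_of_shear_mem x hbm' hq'𝔭 (hact'.2 _ hact'.1))
        · have hm'l : m' ≠ l := fun e => hlsh (e ▸ hm')
          rw [if_neg hact', pderiv_farj_of_ne (fun e => hm'j (Fin.succ_injective _ e))
            (fun e => hm'l (Fin.succ_injective _ e))]
          exact x.asIdeal.zero_mem
      · exact absurd rfl hne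
      · have hi'l : i' ≠ l := fun e => hlfs (e ▸ hi')
        rw [(hF x i' hij' hi'l).1]
        by_cases hact' : act x i'
        · -- `F_j` and an active `Fᵢ`: equal heights, excluded
          exfalso
          have hXi : (X i'.succ : A 4 K) ∈ x.asIdeal := hact'.2 _ hact'.1
          obtain ⟨-, hbi, -⟩ := far_active x (hd i' hi') hq'𝔭 hXi
          exact hC2 i' hi' hij' ((hmemΛ i').mp hact'.1) hbi hjfs (height_eq_of_farj_mem x (hd i' hi') hq'𝔭 hXi hq𝔭)
        · rw [if_neg hact', pderiv_farj_of_ne (fun e => hij' (Fin.succ_injective _ e)) (fun e => hi'l (Fin.succ_injective _ e))]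
          exact x.asIdeal.zero_mem
    · -- `q = Fᵢ`
      have hil : i ≠ l := fun e => hlfs (e ▸ hi)
      rcases hcases x q' hq' with ⟨k', a', rfl, -⟩ | ⟨m', hm', hbm', rfl⟩ | ⟨hjfs', rfl⟩ | ⟨i', hi', hij', rfl⟩
      · exfalso
        rw [(hhyp x k' a').2, (hF x i hij hil).2] at hρle
        split_ifs at hρle <;> omega
      · have hm'j : m' ≠ j := fun e => hjsh (e ▸ hm')
        have hm'l : m' ≠ l := fun e => hlsh (e ▸ hm')
        rw [(hSh x m' hm'j hbm').1]
        by_cases hact' : act x m'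
        · rw [if_pos hact']
          by_cases hact : act x i
          · exfalso
            exact (far_active x (hd i hi) hq𝔭 (hact.2 _ hact.1)).2.2 (X_j_mem_of_shear_mem x hbm' hq'𝔭 (hact'.2 _ hact'.1))
          · exfalso
            rw [(hF x i hij hil).2, (hSh x m' hm'j hbm').2, if_neg hact, if_pos hact'] at hρle
            omega
        · rw [if_neg hact']
          by_cases hmi : m' = i
          · exfalso
            subst hmi
            exact (not_mem_of_far_mem x (hd m' hi) hq𝔭).2 hq'𝔭
          · rw [pderiv_far_of_ne (fun e => hmi (Fin.succ_injective _ e)) (fun e => hm'j (Fin.succ_injective _ e))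
              (fun e => hm'l (Fin.succ_injective _ e))]
            exact x.asIdeal.zero_mem
      · rw [(hFj x).1]
        exfalso
        have hact : act x i := by
          rw [(hF x i hij hil).2, (hFj x).2] at hρle
          by_contra h; rw [if_neg h] at hρle; omega
        have hXi : (X i.succ : A 4 K) ∈ x.asIdeal := hact.2 _ hact.1
        obtain ⟨-, hbi, -⟩ := far_active x (hd i hi) hq𝔭 hXi
        exact hC2 i hi hij ((hmemΛ i).mp hact.1) hbi hjfs' (height_eq_of_farj_mem x (hd i hi) hq𝔭 hXi hq'𝔭)
      · have hi'l : i' ≠ l := fun e => hlfs (e ▸ hi')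
        have hii' : i ≠ i' := fun e => hne (by rw [e])
        rw [(hF x i' hij' hi'l).1]
        by_cases hact' : act x i'
        · -- both active: twin heights, excluded
          exfalso
          have hact : act x i := by
            rw [(hF x i hij hil).2, (hF x i' hij' hi'l).2, if_pos hact'] at hρle
            by_contra h; rw [if_neg h] at hρle; omega
          have hXi : (X i.succ : A 4 K) ∈ x.asIdeal := hact.2 _ hact.1
          have hXi' : (X i'.succ : A 4 K) ∈ x.asIdeal := hact'.2 _ hact'.1
          obtain ⟨-, hbi, -⟩ := far_active x (hd i hi) hq𝔭 hXi
          obtain ⟨-, hbi', -⟩ := far_active x (hd i' hi') hq'𝔭 hXi'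
          exact hC3 i hi i' hi' hij hij' hii' ((hmemΛ i).mp hact.1) ((hmemΛ i').mp hact'.1) hbi hbi'
            (height_eq_of_far_mem_of_far_mem x (hd i hi) (hd i' hi') hq𝔭 hXi hq'𝔭 hXi')
        · rw [if_neg hact', pderiv_far_of_ne (fun e => hii' (Fin.succ_injective _ e).symm)
            (fun e => hij' (Fin.succ_injective _ e)) (fun e => hi'l (Fin.succ_injective _ e))]
          exact x.asIdeal.zero_mem

end ChartDictionary

end Summit.ResolutionOfSingularities.ResolutionOfSingularities.Theorems.PIDim4

end
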